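import Summits.QuantumFields.BalabanUV.Beta.AssembledJetChartCovariance

/-!
# AssembledJetChartCovarianceRelative — the (R33-3) letter certificate in the AXIAL-GAUGE currency: the assembled
# one-loop jets traced against a RELATIVE inverse (`K·H = Π ≠ 1`) are still blind to an orthogonal re-charting that
# respects the gauge-fixed coordinates

HONEST FRAMING (cell charter, verbatim): «discharging BetaPertH makes Balaban's UV stability UNCONDITIONAL — a real
constructive-QFT result; it is NOT the continuum limit and NOT the Clay problem.»  This file is a CELL CERTIFICATE
(pub-balaban β sub-cell, lane an2 gen 11; item (ii) of the β-lead's RULING (R33-A-2′) «`hR_of_cov_conj := (iv) ∘ (ii)`»):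
a finite-dimensional, kernel-checked identity of matrix calculus.  It is NOT a statement of Bałaban's papers, carries no
`[cite:]` tag, asserts nothing about the manuscripts under audit, instantiates NO binder of the wall and discharges NOTHING
of `BetaPertH`.

WHY THIS FILE.  The sibling certificate `AssembledJetChartCovariance` (`jet₂_defect`, `jet₂_congruence_orthogonal`) and its
kernel-level twin (an5's `ChartConjugation.hess_conj_invariant`, sockets `comp A 𝕄 = idK`, `comp 𝕄 A = idK`) assume a
TWO-SIDED inverse `K·H = H·K = 1`.  The cell's one-step kernels are traced against the AXIALLY DRESSED resolvent: by trace
cyclicity `tr(K·Πᵀ S Π) = tr(Π K Πᵀ·S)`, so the kernel that meets the UNDRESSED jets is `G := Π K Πᵀ`, and for a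
gauge-invariant Hessian `H` (`H·g = 0` on gauge modes) and the axial projector `Π` (onto the gauge-fixed coordinate
subspace `V = range E`, ALONG the gauge modes) one has `G·H = Π`, `H·G = Πᵀ` — a RELATIVE inverse, never `1`
(§3 `axial_witness_ne_one`: already for one gauge mode in two variables).  This file proves that the assembled second jet
is NEVERTHELESS invariant under the congruence `H̃(B) = R(B)ᵀ·H(B)·R(B)` by a re-charting `R = 1 + ΣB A_b + …` that is
orthogonal to second order AND COMMUTES WITH THE COORDINATE PROJECTOR `E` (bond-diagonal re-chartings do: the reflection's
`Ad(e^{−B_b})` acts bond by bond), using ONLY the four relative rules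
`E·K = K`, `K·E = K` (the dressed resolvent lives on `V`), `K·H·E = E`, `E·H·K = E` (it inverts `H` ON `V`).
With `E = 1` every statement specialises to the sibling's two-sided one.

CONTENT.  §1 the three trace rules (`rule_right : K·X·H·K = K·X`, `rule_left : K·H·X·K = X·K`, `trace_KHY = tr(E·Y)`,
`trace_KYH = tr(E·Y)` for `X`, `Y` commuting with `E`); §2 **`jet₂_defect_relative`**: `J̃₂ = J₂ + ((tr(E·L2) − tr(E·Lb·Lc)) +
(tr(E·A2) − tr(E·Ab·Ac)))` — the defect is the `E`-COMPRESSED `(b,c)`-jet of `log det L + log det R` (sibling: `E = 1`);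
`jet₁_defect_relative`; **`jet₂_congruence_orthogonal_relative`** (skew `Ab`, `Ac`, orthogonality jet relation, all three
commuting with `E`, `Eᵀ = E` ⇒ `J̃₂ = J₂`); §3 the axial witness (`Fin 2`, one gauge mode `(1,1)`, `V = {x₁ = 0}`):
the four rules hold and `K·H ≠ 1`.

USE (typing consequence for (ii)/(iii)/(iv), stated here so that it is checkable against the definitions): the kernel-level
END `ChartConjugationEnd.axisReflectionCovariant_flipK_TbalOf_conj` is to be fed, for the DRESSED centred family, through the
relative rules with `A := Π_c K_j Π_cᵀ` (the dressed step resolvent), `𝕄 := H_j` (undressed bordered Hessian), `E :=` the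
coordinate projector killing the comb bonds, and bond-diagonal contact generators — not through `comp A 𝕄 = idK`.
All declarations `[folklore]`; axioms ⊆ {propext, Classical.choice, Quot.sound}.

Provenance: b2b-balaban β sub-cell, lane an2 gen 11, 2026-08-19 (v1.0).  Placement: cell topic
`Summits/QuantumFields/BalabanUV/Beta/` (RULING (R34-A)); imports only its sibling certificate; imported by nothing under
`Literature/`.
-/

namespace Summit.QuantumFields.BalabanUV.Beta.AssembledJetChartCovarianceRelative

open Matrix
open Summit.QuantumFields.BalabanUV.Beta.AssembledJetChartCovariance (J₁ J₂ S₁' W₂')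

variable {n : Type*} [Fintype n]

section Rules

variable {K H E : Matrix n n ℝ}

/-- [folklore] `E` commutes with a product of two matrices commuting with `E`. -/
theorem comm_mul {X Y : Matrix n n ℝ} (hX : E * X = X * E) (hY : E * Y = Y * E) : E * (X * Y) = X * Y * E := by
  rw [← Matrix.mul_assoc, hX, Matrix.mul_assoc, hY, ← Matrix.mul_assoc]

/-- [folklore] RIGHT RULE: `K·X·H·K = K·X` for `X` commuting with `E` (from `K·E = K`, `E·H·K = E`). -/
theorem rule_right (hKE : K * E = K) (hEHK : E * H * K = E) {X : Matrix n n ℝ} (hX : E * X = X * E) :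
    K * X * H * K = K * X := by
  have h1 : K * X = K * X * E := by rw [Matrix.mul_assoc, ← hX, ← Matrix.mul_assoc, hKE]
  calc K * X * H * K = K * X * E * H * K := by nth_rewrite 1 [h1]; rfl
    _ = K * X * (E * H * K) := by simp only [Matrix.mul_assoc]
    _ = K * X * E := by rw [hEHK]
    _ = K * X := h1.symm

/-- [folklore] LEFT RULE: `K·H·X·K = X·K` for `X` commuting with `E` (from `E·K = K`, `K·H·E = E`). -/
theorem rule_left (hEK : E * K = K) (hKHE : K * H * E = E) {X : Matrix n n ℝ} (hX : E * X = X * E) :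
    K * H * X * K = X * K := by
  have h2 : X * K = E * (X * K) := by rw [← Matrix.mul_assoc, hX, Matrix.mul_assoc, hEK]
  calc K * H * X * K = K * H * (X * K) := Matrix.mul_assoc _ _ _
    _ = K * H * (E * (X * K)) := by nth_rewrite 1 [h2]; rfl
    _ = K * H * E * (X * K) := by simp only [Matrix.mul_assoc]
    _ = E * (X * K) := by rw [hKHE]
    _ = X * K := h2.symm

/-- [folklore] `tr(K·H·Y) = tr(E·Y)` for `Y` commuting with `E` (from `E·K = K`, `K·H·E = E`). -/
theorem trace_KHY (hEK : E * K = K) (hKHE : K * H * E = E) {Y : Matrix n n ℝ} (hY : E * Y = Y * E) :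
    (K * H * Y).trace = (E * Y).trace := by
  have h3 : Y * K = E * Y * K := by
    calc Y * K = Y * (E * K) := by rw [hEK]
      _ = Y * E * K := (Matrix.mul_assoc _ _ _).symm
      _ = E * Y * K := by rw [← hY]
  calc (K * H * Y).trace = (Y * (K * H)).trace := Matrix.trace_mul_comm _ _
    _ = (Y * K * H).trace := by rw [← Matrix.mul_assoc]
    _ = (E * Y * K * H).trace := by nth_rewrite 1 [h3]; rfl
    _ = (E * (Y * K * H)).trace := by simp only [Matrix.mul_assoc]
    _ = (Y * K * H * E).trace := Matrix.trace_mul_comm _ _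
    _ = (Y * (K * H * E)).trace := by simp only [Matrix.mul_assoc]
    _ = (Y * E).trace := by rw [hKHE]
    _ = (E * Y).trace := by rw [← hY]

/-- [folklore] `tr(K·Y·H) = tr(E·Y)` for `Y` commuting with `E` (from `K·E = K`, `E·H·K = E`). -/
theorem trace_KYH (hKE : K * E = K) (hEHK : E * H * K = E) {Y : Matrix n n ℝ} (hY : E * Y = Y * E) :
    (K * Y * H).trace = (E * Y).trace := by
  have h1 : K * Y = K * Y * E := by rw [Matrix.mul_assoc, ← hY, ← Matrix.mul_assoc, hKE]
  calc (K * Y * H).trace = (K * Y * E * H).trace := by nth_rewrite 1 [h1]; rfl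
    _ = (K * Y * (E * H)).trace := by simp only [Matrix.mul_assoc]
    _ = (E * H * (K * Y)).trace := Matrix.trace_mul_comm _ _
    _ = (E * H * K * Y).trace := by simp only [Matrix.mul_assoc]
    _ = (E * Y).trace := by rw [hEHK]

end Rules

section Defect

variable {K H E : Matrix n n ℝ}

/-- [folklore] **FIRST-JET DEFECT LAW, RELATIVE FORM**: `J̃₁ = J₁ + (tr(E·Lb) + tr(E·Ab))`. -/
theorem jet₁_defect_relative (hEK : E * K = K) (hKE : K * E = K) (hKHE : K * H * E = E) (hEHK : E * H * K = E)
    {S Lb Ab : Matrix n n ℝ} (hLb : E * Lb = Lb * E) (hAb : E * Ab = Ab * E) :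
    J₁ K (S₁' H S Lb Ab) = J₁ K S + ((E * Lb).trace + (E * Ab).trace) := by
  have c1 : (K * (Lb * H)).trace = (E * Lb).trace := by rw [← Matrix.mul_assoc, trace_KYH hKE hEHK hLb]
  have c2 : (K * (H * Ab)).trace = (E * Ab).trace := by rw [← Matrix.mul_assoc, trace_KHY hEK hKHE hAb]
  unfold J₁ S₁'
  simp only [Matrix.mul_add, Matrix.trace_add]
  linarith [c1, c2]

/-- [folklore] **SECOND-JET DEFECT LAW, RELATIVE FORM**: traced against a relative inverse (`E·K = K·E = K`,
`K·H·E = E·H·K = E`) and for re-charting jets commuting with `E`, `J̃₂ = J₂ + ((tr(E·L2) − tr(E·Lb·Lc)) + (tr(E·A2) −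
tr(E·Ab·Ac)))` — the defect is the `E`-compressed `(b,c)`-jet of `log det L + log det R`; every contact term cancels between
tadpole and bubble exactly as in the two-sided case (`AssembledJetChartCovariance.jet₂_defect` is `E = 1`). -/
theorem jet₂_defect_relative (hEK : E * K = K) (hKE : K * E = K) (hKHE : K * H * E = E) (hEHK : E * H * K = E)
    {Sb Sc W Lb Lc L2 Ab Ac A2 : Matrix n n ℝ} (hLb : E * Lb = Lb * E) (hLc : E * Lc = Lc * E)
    (hL2 : E * L2 = L2 * E) (hAb : E * Ab = Ab * E) (hAc : E * Ac = Ac * E) (hA2 : E * A2 = A2 * E) :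
    J₂ K (S₁' H Sb Lb Ab) (S₁' H Sc Lc Ac) (W₂' H Sb Sc W Lb Lc L2 Ab Ac A2) =
      J₂ K Sb Sc W + (((E * L2).trace - (E * (Lb * Lc)).trace) + ((E * A2).trace - (E * (Ab * Ac)).trace)) := by
  -- the eight contact rearrangements (relative rules) and the two defect traces
  have e1 : (K * (Sb * (K * (Lc * H)))).trace = (K * (Lc * Sb)).trace := by
    calc (K * (Sb * (K * (Lc * H)))).trace = (K * Sb * (K * Lc * H)).trace := by simp only [Matrix.mul_assoc]
      _ = (K * Lc * H * (K * Sb)).trace := Matrix.trace_mul_comm _ _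
      _ = (K * Lc * H * K * Sb).trace := by simp only [Matrix.mul_assoc]
      _ = (K * Lc * Sb).trace := by rw [rule_right hKE hEHK hLc]
      _ = (K * (Lc * Sb)).trace := by rw [Matrix.mul_assoc]
  have e2 : (K * (Sb * (K * (H * Ac)))).trace = (K * (Sb * Ac)).trace := by
    calc (K * (Sb * (K * (H * Ac)))).trace = (K * Sb * (K * H * Ac)).trace := by simp only [Matrix.mul_assoc]
      _ = (K * H * Ac * (K * Sb)).trace := Matrix.trace_mul_comm _ _
      _ = (K * H * Ac * K * Sb).trace := by simp only [Matrix.mul_assoc]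
      _ = (Ac * K * Sb).trace := by rw [rule_left hEK hKHE hAc]
      _ = (Ac * (K * Sb)).trace := by rw [Matrix.mul_assoc]
      _ = (K * Sb * Ac).trace := Matrix.trace_mul_comm _ _
      _ = (K * (Sb * Ac)).trace := by rw [Matrix.mul_assoc]
  have e3 : (K * (Lb * (H * (K * Sc)))).trace = (K * (Lb * Sc)).trace := by
    calc (K * (Lb * (H * (K * Sc)))).trace = (K * Lb * H * K * Sc).trace := by simp only [Matrix.mul_assoc]
      _ = (K * Lb * Sc).trace := by rw [rule_right hKE hEHK hLb]
      _ = (K * (Lb * Sc)).trace := by rw [Matrix.mul_assoc]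
  have e4 : (K * (Lb * (H * (K * (H * Ac))))).trace = (K * (Lb * (H * Ac))).trace := by
    calc (K * (Lb * (H * (K * (H * Ac))))).trace = (K * Lb * H * K * (H * Ac)).trace := by simp only [Matrix.mul_assoc]
      _ = (K * Lb * (H * Ac)).trace := by rw [rule_right hKE hEHK hLb]
      _ = (K * (Lb * (H * Ac))).trace := by rw [Matrix.mul_assoc]
  have e5 : (K * (H * (Ab * (K * Sc)))).trace = (K * (Sc * Ab)).trace := by
    calc (K * (H * (Ab * (K * Sc)))).trace = (K * H * Ab * K * Sc).trace := by simp only [Matrix.mul_assoc]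
      _ = (Ab * K * Sc).trace := by rw [rule_left hEK hKHE hAb]
      _ = (Ab * (K * Sc)).trace := by rw [Matrix.mul_assoc]
      _ = (K * Sc * Ab).trace := Matrix.trace_mul_comm _ _
      _ = (K * (Sc * Ab)).trace := by rw [Matrix.mul_assoc]
  have e6 : (K * (H * (Ab * (K * (Lc * H))))).trace = (K * (Lc * (H * Ab))).trace := by
    calc (K * (H * (Ab * (K * (Lc * H))))).trace = (K * H * Ab * K * (Lc * H)).trace := by simp only [Matrix.mul_assoc]
      _ = (Ab * K * (Lc * H)).trace := by rw [rule_left hEK hKHE hAb]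
      _ = (Ab * (K * Lc * H)).trace := by simp only [Matrix.mul_assoc]
      _ = (K * Lc * H * Ab).trace := Matrix.trace_mul_comm _ _
      _ = (K * (Lc * (H * Ab))).trace := by simp only [Matrix.mul_assoc]
  have e7 : (K * (Lb * (H * (K * (Lc * H))))).trace = (E * (Lb * Lc)).trace := by
    calc (K * (Lb * (H * (K * (Lc * H))))).trace = (K * Lb * H * K * Lc * H).trace := by simp only [Matrix.mul_assoc]
      _ = (K * Lb * Lc * H).trace := by rw [rule_right hKE hEHK hLb]
      _ = (K * (Lb * Lc) * H).trace := by simp only [Matrix.mul_assoc]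
      _ = (E * (Lb * Lc)).trace := trace_KYH hKE hEHK (comm_mul hLb hLc)
  have e8 : (K * (H * (Ab * (K * (H * Ac))))).trace = (E * (Ab * Ac)).trace := by
    calc (K * (H * (Ab * (K * (H * Ac))))).trace = (K * H * Ab * K * (H * Ac)).trace := by simp only [Matrix.mul_assoc]
      _ = (Ab * K * (H * Ac)).trace := by rw [rule_left hEK hKHE hAb]
      _ = (Ab * (K * H * Ac)).trace := by simp only [Matrix.mul_assoc]
      _ = (K * H * Ac * Ab).trace := Matrix.trace_mul_comm _ _
      _ = (K * H * (Ac * Ab)).trace := by simp only [Matrix.mul_assoc]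
      _ = (E * (Ac * Ab)).trace := trace_KHY hEK hKHE (comm_mul hAc hAb)
      _ = (E * Ac * Ab).trace := by rw [Matrix.mul_assoc]
      _ = (Ab * (E * Ac)).trace := Matrix.trace_mul_comm _ _
      _ = (Ab * E * Ac).trace := by rw [Matrix.mul_assoc]
      _ = (E * Ab * Ac).trace := by rw [← hAb]
      _ = (E * (Ab * Ac)).trace := by rw [Matrix.mul_assoc]
  have e9 : (K * (L2 * H)).trace = (E * L2).trace := by rw [← Matrix.mul_assoc, trace_KYH hKE hEHK hL2]
  have e10 : (K * (H * A2)).trace = (E * A2).trace := by rw [← Matrix.mul_assoc, trace_KHY hEK hKHE hA2]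
  unfold J₂ S₁' W₂'
  simp only [Matrix.mul_add, Matrix.add_mul, Matrix.trace_add, Matrix.mul_assoc]
  linarith [e1, e2, e3, e4, e5, e6, e7, e8, e9, e10]

/-- [folklore] Second jet, relative form: invariance when the `E`-compressed second jet of `log det L + log det R`
vanishes. -/
theorem jet₂_invariant_of_unimodular_relative (hEK : E * K = K) (hKE : K * E = K) (hKHE : K * H * E = E)
    (hEHK : E * H * K = E) {Sb Sc W Lb Lc L2 Ab Ac A2 : Matrix n n ℝ} (hLb : E * Lb = Lb * E)
    (hLc : E * Lc = Lc * E) (hL2 : E * L2 = L2 * E) (hAb : E * Ab = Ab * E) (hAc : E * Ac = Ac * E)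
    (hA2 : E * A2 = A2 * E)
    (h : ((E * L2).trace - (E * (Lb * Lc)).trace) + ((E * A2).trace - (E * (Ab * Ac)).trace) = 0) :
    J₂ K (S₁' H Sb Lb Ab) (S₁' H Sc Lc Ac) (W₂' H Sb Sc W Lb Lc L2 Ab Ac A2) = J₂ K Sb Sc W := by
  rw [jet₂_defect_relative hEK hKE hKHE hEHK hLb hLc hL2 hAb hAc hA2, h, add_zero]

/-- [folklore] Transposed commutation: if `Eᵀ = E` and `E·X = X·E` then `E·Xᵀ = Xᵀ·E`. -/
theorem comm_transpose {E X : Matrix n n ℝ} (hEt : Eᵀ = E) (hX : E * X = X * E) : E * Xᵀ = Xᵀ * E := by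
  have h := congrArg Matrix.transpose hX
  rw [Matrix.transpose_mul, Matrix.transpose_mul, hEt] at h
  exact h.symm

/-- [folklore] **CONGRUENCE BY AN ORTHOGONAL, `E`-COMPATIBLE RE-CHARTING, RELATIVE FORM** `H̃ = Rᵀ·H·R` traced against a
RELATIVE inverse: with `R` orthogonal to second order (`Abᵀ = −Ab`, `Acᵀ = −Ac`, `A2ᵀ + A2 + Abᵀ·Ac + Acᵀ·Ab = 0`), its jets
commuting with the symmetric coordinate projector `E`, and the four relative rules, the assembled second jet is invariant.
THE AXIAL-GAUGE FORM of the lead's `hR_of_cov_conj` mechanism (`AssembledJetChartCovariance.jet₂_congruence_orthogonal` is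
`E = 1`). -/
theorem jet₂_congruence_orthogonal_relative (hEK : E * K = K) (hKE : K * E = K) (hKHE : K * H * E = E)
    (hEHK : E * H * K = E) (hEt : Eᵀ = E) {Sb Sc W Ab Ac A2 : Matrix n n ℝ} (hAbE : E * Ab = Ab * E)
    (hAcE : E * Ac = Ac * E) (hA2E : E * A2 = A2 * E) (hAb : Abᵀ = -Ab) (hAc : Acᵀ = -Ac)
    (hrel : A2ᵀ + A2 + Abᵀ * Ac + Acᵀ * Ab = 0) :
    J₂ K (S₁' H Sb Abᵀ Ab) (S₁' H Sc Acᵀ Ac) (W₂' H Sb Sc W Abᵀ Acᵀ A2ᵀ Ab Ac A2) = J₂ K Sb Sc W := by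
  apply jet₂_invariant_of_unimodular_relative hEK hKE hKHE hEHK (comm_transpose hEt hAbE) (comm_transpose hEt hAcE)
    (comm_transpose hEt hA2E) hAbE hAcE hA2E
  -- the E-traced orthogonality relation
  have ht : (E * (A2ᵀ + A2 + Abᵀ * Ac + Acᵀ * Ab)).trace = 0 := by rw [hrel, Matrix.mul_zero, Matrix.trace_zero]
  have t1 : (E * A2ᵀ).trace = (E * A2).trace := by
    rw [← hEt, ← Matrix.transpose_mul, Matrix.trace_transpose, hEt]
    exact Matrix.trace_mul_comm _ _
  have t2 : (E * (Abᵀ * Acᵀ)).trace = (E * (Ab * Ac)).trace := by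
    rw [← Matrix.transpose_mul, ← hEt, ← Matrix.transpose_mul, Matrix.trace_transpose, hEt]
    calc (Ac * Ab * E).trace = (Ac * (Ab * E)).trace := by rw [Matrix.mul_assoc]
      _ = (Ac * (E * Ab)).trace := by rw [hAbE]
      _ = (E * Ab * Ac).trace := by rw [Matrix.trace_mul_comm, Matrix.mul_assoc]
      _ = (E * (Ab * Ac)).trace := by rw [Matrix.mul_assoc]
  have t3 : (E * (Ac * Ab)).trace = (E * (Ab * Ac)).trace := by
    calc (E * (Ac * Ab)).trace = (E * Ac * Ab).trace := by rw [Matrix.mul_assoc]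
      _ = (Ab * (E * Ac)).trace := Matrix.trace_mul_comm _ _
      _ = (Ab * E * Ac).trace := by rw [Matrix.mul_assoc]
      _ = (E * Ab * Ac).trace := by rw [← hAbE]
      _ = (E * (Ab * Ac)).trace := by rw [Matrix.mul_assoc]
  simp only [hAb, hAc, Matrix.mul_add, Matrix.trace_add, neg_mul, mul_neg, neg_neg, Matrix.trace_neg] at ht t2 ⊢
  linarith [ht, t1, t2, t3]

/-- [folklore] First-jet twin: `J̃₁ = J₁` needs only skewness and `E`-compatibility of `Ab`. -/
theorem jet₁_congruence_orthogonal_relative (hEK : E * K = K) (hKE : K * E = K) (hKHE : K * H * E = E)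
    (hEHK : E * H * K = E) (hEt : Eᵀ = E) {S Ab : Matrix n n ℝ} (hAbE : E * Ab = Ab * E) (hAb : Abᵀ = -Ab) :
    J₁ K (S₁' H S Abᵀ Ab) = J₁ K S := by
  rw [jet₁_defect_relative hEK hKE hKHE hEHK (comm_transpose hEt hAbE) hAbE, hAb, Matrix.mul_neg, Matrix.trace_neg,
    neg_add_cancel, add_zero]

end Defect

section AxialWitness

/-- [folklore] THE AXIAL WITNESS, `n = Fin 2`: one gauge mode `g = (1,1)` (`H = [[1,−1],[−1,1]]`, `H·g = 0`), the axial
subspace `V = {x₁ = 0}` with coordinate projector `E = diag(1,0)`, and the dressed resolvent `K = (E·H·E)⁺ = diag(1,0)`: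
the four relative rules hold … -/
theorem axial_witness_rules :
    let K : Matrix (Fin 2) (Fin 2) ℝ := !![1, 0; 0, 0]
    let H : Matrix (Fin 2) (Fin 2) ℝ := !![1, -1; -1, 1]
    let E : Matrix (Fin 2) (Fin 2) ℝ := !![1, 0; 0, 0]
    E * K = K ∧ K * E = K ∧ K * H * E = E ∧ E * H * K = E := by
  refine ⟨?_, ?_, ?_, ?_⟩ <;> (ext i j; fin_cases i <;> fin_cases j <;> simp [Matrix.mul_apply, Fin.sum_univ_two])

/-- [folklore] … while `K·H = Π = [[1,−1],[0,0]] ≠ 1` (the projector onto `V` ALONG the gauge mode): the two-sided socket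
`comp A 𝕄 = idK` of the kernel-level END is NOT available for the dressed family. -/
theorem axial_witness_ne_one :
    let K : Matrix (Fin 2) (Fin 2) ℝ := !![1, 0; 0, 0]
    let H : Matrix (Fin 2) (Fin 2) ℝ := !![1, -1; -1, 1]
    K * H ≠ 1 := by
  intro K H h
  have h11 := congrFun (congrFun h 1) 1
  simp [K, H, Matrix.mul_apply, Fin.sum_univ_two] at h11

end AxialWitness

end Summit.QuantumFields.BalabanUV.Beta.AssembledJetChartCovarianceRelative
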